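import Summits.NavierStokesRegularity.OSWSelfSimilar.SheetRLinearisedRenewal
import Summits.NavierStokesRegularity.OSWSelfSimilar.SheetRRenewalScalar
import Literature.Analysis.UnboundedOperators.RankOneMildRenewal
import Literature.Analysis.UnboundedOperators.RankOneKernelRegularity
import HarnessLib

/-!
# SHEET-ℝ, Z3-SR-SPEC: «LINEARLY STABLE MODULO GAUGE» for the linearised flow — the renewal route composed end to end

HONEST FRAMING (cell ns-blowup GROUP B / zone Z3, case Z3-SR-SPEC, P-list (P9) KERNEL / (P10) NOT CLAIMED by the lead; renewal route of memo
`HOME/profile/cert/cert5/P9-P10-RENEWAL-DESIGN.md` v2 §1: (R-a) selfsim g13 `RankOneDuhamelRenewal` + `SheetRLinearisedRenewal`, (R-b) cert-5 g6 `SheetRRenewalBookkeeping`,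
(R-b′)/(R-c)/(R-e) cert-5 g7 `Literature/Analysis/Convolution/RenewalResolvent{,Symbol,Pole}`, `RankOneMildRenewal`, `RankOneKernelRegularity`,
`SheetRRenewalScalar`; 0 kit; 1-D MODEL certificate frame; not Euler/NS; «violates: none — MODEL»). NOTHING here asserts that a hypothesis holds.

THE THEOREM (`flow_sub_gaugeMode_le`). Let `h : GardingDataKC …` be the (S1) datum of `A_F = T + F`-encoding on the odd class (`T = generatorOdd`), let `S`, `S_F`
be C₀-semigroups with the generator data of `SheetRLinearisedSemigroup.exists_c0Semigroup` (`S.generator = T`, `‖S(τ)‖ ≤ e^{−mτ}`, Laplace `= resolventOdd`) and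
`SheetRLinearisedFlow.exists_c0Semigroup_full` (`D(S_F.generator) = D(T)`, `S_F.generator = T + θℓ(·)f`), assume `f ∈ D(T)` (regularity of the rank-one vector —
for the frame's `f = v₀`, the `E`-Riesz representer of twelve smooth dyadics, a smoothness fact about the PINNED `v₀`, left as THE ONE named hypothesis here),
and let the Evans function `E = evansOdd hL K h ℓ f θ` have NO zero in `{Re σ > −β₀} ∖ {1}` and a SIMPLE zero at `1` (`0 < β₀ ≤ m`; the S2 sentences of record give
`β₀ = 3/100`, via `SheetREvansOdd.exists_weakEigen_iff_evansOdd_eq_zero`). Then for every `0 < β′ < β₀` there is `M` with, for ALL data `δ₀` and `t ≥ 0`,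
    `‖S_F(t)δ₀ − c(δ₀)e^{t}·R(1)f‖ ≤ M‖δ₀‖e^{−β′t}`,   `c(δ₀) = E′(1)⁻¹·∫₀^∞ e^{−s}θℓ(S(s)δ₀) ds`  (`= θℓ(R(1)δ₀)/E′(1)`),
`R(1)f = ∫₀^∞e^{−σ}S(σ)f dσ` the gauge-mode direction (`R_{K}(1)f`, the eigenvector of record of `SheetRSpectrumEndToEnd.weakEigen_one_simple_*`): every orbit of the
linearised flow is the growing gauge mode with an explicit «adjoint pairing» coefficient plus a remainder decaying at rate `β′` — the word «LINEARLY STABLE MODULO GAUGE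
(MODEL)» as ONE kernel theorem modulo {(S1) datum, (P9) generator data, `f ∈ D(T)`, S2 zero-set sentences}. `flow_decay_of_orthogonal`: decay on the hyperplane
`∫₀^∞ e^{−s}θℓ(S(s)δ₀) ds = 0`.
WHAT THIS IS NOT: not NS; no interval arithmetic; no number of record moves; the semigroups, `f ∈ D(T)` and the S2 sentences are HYPOTHESES.
-/

noncomputable section

namespace Summit.NavierStokesRegularity.OSWSelfSimilar
namespace SheetRLinearisedStability

open _root_.MeasureTheory _root_.Set _root_.Filter _root_.Complex SheetREnergySpace SheetRComplexPivot SheetRPerturbedResolventC SheetROddClass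
  SheetRResolventOddClass SheetRGeneratorOddWeak SheetREvansOdd SheetRLinearisedSemigroup SheetRLinearisedFlow SheetRLinearisedRenewal
  Literature.Analysis.OperatorTheory Literature.Analysis.UnboundedOperators Literature.Analysis.Complex Literature.Analysis.Convolution
open scoped Topology NNReal

variable {L D₀ D₁ V₀ c m : ℝ} {d V : ℝ → ℝ}

/-- **«LINEARLY STABLE MODULO GAUGE» (MODEL), vector form.** See the module docstring. [folklore] -/
theorem flow_sub_gaugeMode_le (hL : 0 < L) (K : Esp L hL →L[ℝ] W L) (h : GardingDataKC L hL d V K D₀ D₁ V₀ c m)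
    {σ₀ : ℂ} (hσ₀ : -m < σ₀.re) (hm : 0 < m)
    (ℓ : Wcodd L →L[ℂ] ℂ) (f : Wcodd L) (θ : ℂ) (S SF : C0Semigroup ℂ (Wcodd L))
    (hS : S.generator = generatorOdd hL K h σ₀ hσ₀) (hSM : ∀ τ : ℝ≥0, ‖S.app τ‖ ≤ Real.exp (-m * τ))
    (hlap : ∀ σ : ℂ, -m < σ.re → ∀ G : Wcodd L, S.laplaceResolventFun σ G = resolventOdd hL K h σ G)
    (hdomF : (SF.generator.domain : Set (Wcodd L)) = (generatorOdd hL K h σ₀ hσ₀).domain)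
    (hgenF : ∀ (u : Wcodd L) (hu : u ∈ (generatorOdd hL K h σ₀ hσ₀).domain), ∃ hu' : u ∈ SF.generator.domain,
      SF.generator ⟨u, hu'⟩ = generatorOdd hL K h σ₀ hσ₀ ⟨u, hu⟩ + (θ * ℓ u) • f)
    (hf : f ∈ (generatorOdd hL K h σ₀ hσ₀).domain)
    {β₀ β' : ℝ} (hβ₀ : 0 < β₀) (hβ₀m : β₀ ≤ m) (hβ' : 0 < β') (hβ'β₀ : β' < β₀)
    (hzero : ∀ σ : ℂ, -β₀ < σ.re → σ ≠ 1 → evansOdd hL K h ℓ f θ σ ≠ 0)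
    (hE1 : evansOdd hL K h ℓ f θ 1 = 0) (hE'1 : deriv (evansOdd hL K h ℓ f θ) 1 ≠ 0) :
    ∃ M : ℝ, ∀ (δ₀ : Wcodd L) (t : ℝ), 0 ≤ t →
      ‖SF.app t.toNNReal δ₀ -
        ((deriv (evansOdd hL K h ℓ f θ) 1)⁻¹ *
            (∫ s in Ioi (0 : ℝ), (Real.exp (-s) : ℂ) * (θ * ℓ (S.app s.toNNReal δ₀))) * cexp t) •
          S.laplaceResolventFun 1 f‖ ≤ M * ‖δ₀‖ * Real.exp (-β' * t) := by
  haveI : CompleteSpace (Wcodd L) := completeSpace_Wcodd L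
  set E : ℂ → ℂ := evansOdd hL K h ℓ f θ with hEdef
  -- the kernel `k(τ) = θℓ(S(τ)f)` and its regularity from `f ∈ D(T)` ((r1) via `RankOneKernelRegularity`)
  have hfS : f ∈ S.generator.domain := by rw [hS]; exact hf
  set fd : S.generator.domain := ⟨f, hfS⟩ with hfd
  set Kk : ℝ := ‖θ • ℓ‖ * max ‖f‖ ‖S.generator fd‖ with hKk
  obtain ⟨hk, hk', hd⟩ := S.renewalKernel_fields (θ • ℓ) hSM fd
  -- the symbol is the Evans function ((R-d), zero glue)
  have hE : ∀ s : ℂ, -m < s.re → E s = 1 - laplaceC (fun τ : ℝ => (θ • ℓ) (S.app (Real.toNNReal τ) (fd : Wcodd L))) s := by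
    intro s hs
    have h1 := laplace_kernel_eq_one_sub_evansOdd hL K h ℓ f θ S hSM hlap hs
    have h2 : laplaceC (fun τ : ℝ => (θ • ℓ) (S.app (Real.toNNReal τ) (fd : Wcodd L))) s = 1 - E s := by
      rw [← h1, laplaceC]
      rfl
    rw [h2]; ring
  -- the uniform scalar theorem
  obtain ⟨N', hN'0, hN'⟩ := SheetRRenewalScalar.exists_uniform_renewal_const hk hk' hd hm hE hβ₀ hβ₀m hzero hE1 hE'1 hβ' hβ'β₀
  set P : ℝ := ‖(deriv E 1)⁻¹‖ with hP
  set A : ℝ := ‖θ‖ * ‖ℓ‖ with hA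
  have hA0 : 0 ≤ A := by positivity
  have hP0 : 0 ≤ P := norm_nonneg _
  have hm1 : 0 < 1 + m := by linarith
  have hmβ : 0 < m - β' := by linarith
  -- the constant
  refine ⟨1 + A * (1 + P / (1 + m) + N') * ‖f‖ / (m - β') + P * (A / (1 + m)) * ‖f‖ / (1 + m), fun δ₀ t ht => ?_⟩
  -- the datum and the amplitude
  set m₀ : ℝ → ℂ := fun τ => θ * ℓ (S.app τ.toNNReal δ₀) with hm₀def
  set mm : ℝ → ℂ := fun τ => θ * ℓ (SF.app τ.toNNReal δ₀) with hmmdef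
  have hm₀c : Continuous m₀ := continuous_const.mul (ℓ.continuous.comp (S.continuous_app_toNNReal δ₀))
  have hmmc : Continuous mm := continuous_const.mul (ℓ.continuous.comp (SF.continuous_app_toNNReal δ₀))
  have hb₀ : ∀ s : ℝ, 0 ≤ s → ‖m₀ s‖ ≤ A * ‖δ₀‖ * Real.exp (-m * s) := by
    intro s hs
    have := norm_forcing_le_sheet ℓ θ S hSM δ₀ s.toNNReal
    rw [Real.coe_toNNReal s hs] at this
    simpa [hm₀def, hA, mul_assoc] using this
  have hren : ∀ t : ℝ, 0 ≤ t → mm t = m₀ t + hconv (fun τ : ℝ => (θ • ℓ) (S.app (Real.toNNReal τ) (fd : Wcodd L))) mm t := by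
    intro t ht
    have := renewal_equation_sheet hL K h hσ₀ ℓ f θ S SF hS hdomF hgenF δ₀ ht
    rw [hmmdef, hm₀def, hconv]
    simpa only [_root_.smul_apply, smul_eq_mul] using this
  have hscalar := hN' m₀ mm (A * ‖δ₀‖) m hm₀c hb₀ hmmc hren (by linarith) 
  -- the scalar coefficient and its bound
  set c₁ : ℂ := (deriv E 1)⁻¹ * ∫ s in Ioi (0 : ℝ), (Real.exp (-s) : ℂ) * m₀ s with hc₁
  have hI : ‖∫ s in Ioi (0 : ℝ), (Real.exp (-s) : ℂ) * m₀ s‖ ≤ A * ‖δ₀‖ / (1 + m) := by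
    have := SheetRRenewalBookkeeping.norm_integral_Ioi_exp_mul_le hm₀c hm1 hb₀ (t := 0) le_rfl
    simpa using this
  have hc₁le : ‖c₁‖ ≤ P * (A * ‖δ₀‖ / (1 + m)) := by
    rw [hc₁, norm_mul]; exact mul_le_mul_of_nonneg_left hI hP0
  -- scalar decay in the shape `‖θℓ(S_F(s)δ₀) − c₁e^{s}‖ ≤ M_δ e^{−β′s}`
  set Mδ : ℝ := A * ‖δ₀‖ * (1 + P / (1 + m) + N') with hMδ
  have hsc : ∀ s : ℝ, 0 ≤ s → ‖(θ • ℓ) (SF.app s.toNNReal δ₀) - c₁ * cexp s‖ ≤ Mδ * Real.exp (-β' * s) := by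
    intro s hs
    have h1 := hscalar s hs
    have h2 : (θ • ℓ) (SF.app s.toNNReal δ₀) - c₁ * cexp s =
        mm s - (deriv E 1)⁻¹ * (∫ s in Ioi (0 : ℝ), (Real.exp (-s) : ℂ) * m₀ s) * (Real.exp s : ℂ) := by
      rw [hmmdef, hc₁, Complex.ofReal_exp, _root_.smul_apply, smul_eq_mul]
    rw [h2]; exact h1
  -- the mild form of the flow
  have hmild : ∀ t : ℝ, 0 ≤ t → SF.app t.toNNReal δ₀ = S.app (Real.toNNReal t) δ₀ +
      ∫ s in (0 : ℝ)..t, S.app (Real.toNNReal (t - s)) ((θ • ℓ) (SF.app s.toNNReal δ₀) • f) := by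
    intro t ht
    rw [flow_eq_add_integral_sheet hL K h hσ₀ ℓ f θ S SF hS hdomF hgenF δ₀ ht]
    congr 1
    refine intervalIntegral.integral_congr fun s _ => ?_
    simp only [ContinuousLinearMap.map_smul, _root_.smul_apply, smul_eq_mul]
  -- the vector theorem
  have hvec := C0Semigroup.norm_mild_sub_mode_le (S := S) (ℓ := θ • ℓ) (f := f) (u₀ := δ₀)
    (u := fun t : ℝ => SF.app t.toNNReal δ₀) hSM hm (SF.continuous_app_toNNReal δ₀) hmild hβ' (by linarith) hsc ht
  refine hvec.trans ?_
  -- collect the constant: every term is `≤ (…)·‖δ₀‖·e^{−β′t}`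
  have hexp : 0 < Real.exp (-β' * t) := Real.exp_pos _
  have hδ : 0 ≤ ‖δ₀‖ := norm_nonneg _
  have hf0 : 0 ≤ ‖f‖ := norm_nonneg _
  have ht1 : Mδ * ‖f‖ / (m - β') = (A * (1 + P / (1 + m) + N') * ‖f‖ / (m - β')) * ‖δ₀‖ := by
    rw [hMδ]; field_simp
  have ht2 : ‖c₁‖ * ‖f‖ / (1 + m) ≤ (P * (A / (1 + m)) * ‖f‖ / (1 + m)) * ‖δ₀‖ := by
    have : ‖c₁‖ * ‖f‖ / (1 + m) ≤ P * (A * ‖δ₀‖ / (1 + m)) * ‖f‖ / (1 + m) := by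
      apply div_le_div_of_nonneg_right _ hm1.le
      exact mul_le_mul_of_nonneg_right hc₁le hf0
    refine this.trans (le_of_eq ?_)
    field_simp
  calc (‖δ₀‖ + Mδ * ‖f‖ / (m - β') + ‖c₁‖ * ‖f‖ / (1 + m)) * Real.exp (-β' * t)
      ≤ (‖δ₀‖ + (A * (1 + P / (1 + m) + N') * ‖f‖ / (m - β')) * ‖δ₀‖ +
          (P * (A / (1 + m)) * ‖f‖ / (1 + m)) * ‖δ₀‖) * Real.exp (-β' * t) := by
        refine mul_le_mul_of_nonneg_right ?_ hexp.le
        rw [ht1]; linarith [ht2]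
    _ = (1 + A * (1 + P / (1 + m) + N') * ‖f‖ / (m - β') + P * (A / (1 + m)) * ‖f‖ / (1 + m)) * ‖δ₀‖ *
          Real.exp (-β' * t) := by ring

/-- **The adjoint pairing as a resolvent value**: `∫₀^∞ e^{−s}·θℓ(S(s)G) ds = θℓ(R_K(1)G)` (Laplace bridge at `σ = 1`, `ℓ` through the Bochner integral).
[folklore] -/
theorem integral_exp_neg_mul_apply_eq (hL : 0 < L) (K : Esp L hL →L[ℝ] W L) (h : GardingDataKC L hL d V K D₀ D₁ V₀ c m) (hm : 0 < m)
    (ℓ : Wcodd L →L[ℂ] ℂ) (θ : ℂ) (S : C0Semigroup ℂ (Wcodd L)) (hSM : ∀ τ : ℝ≥0, ‖S.app τ‖ ≤ Real.exp (-m * τ))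
    (hlap : ∀ σ : ℂ, -m < σ.re → ∀ G : Wcodd L, S.laplaceResolventFun σ G = resolventOdd hL K h σ G) (G : Wcodd L) :
    ∫ s in Ioi (0 : ℝ), (Real.exp (-s) : ℂ) * (θ * ℓ (S.app s.toNNReal G)) = θ * ℓ (resolventOdd hL K h 1 G) := by
  haveI : CompleteSpace (Wcodd L) := completeSpace_Wcodd L
  have h1 : -m < (1 : ℂ).re := by simp; linarith
  have hM' : ∀ t : ℝ≥0, ‖S.app t‖ ≤ 1 * Real.exp (-m * t) := fun t => by rw [one_mul]; exact hSM t
  have hint := C0Semigroup.integrableOn_integrand S hM' (l := 1) (by simp; linarith) G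
  have hcomm := ((θ • ℓ).integral_comp_comm hint)
  have hcongr : (fun τ : ℝ => (θ • ℓ) (Complex.exp (-(1 * (τ : ℂ))) • S.app (Real.toNNReal τ) G)) =
      fun τ : ℝ => (Real.exp (-τ) : ℂ) * (θ * ℓ (S.app (Real.toNNReal τ) G)) := by
    funext τ
    rw [map_smul, _root_.smul_apply, smul_eq_mul, smul_eq_mul, Complex.ofReal_exp, one_mul]
    push_cast
    ring
  rw [hcongr] at hcomm
  have hdef : (∫ τ in Ioi (0 : ℝ), Complex.exp (-(1 * (τ : ℂ))) • S.app (Real.toNNReal τ) G) = S.laplaceResolventFun 1 G := rfl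
  rw [hcomm, _root_.smul_apply, smul_eq_mul, hdef, hlap 1 h1 G]

/-- **«LINEARLY STABLE MODULO GAUGE» (MODEL), resolvent form of the coefficient and of the mode**: for all `δ₀`, `t ≥ 0`,
`‖S_F(t)δ₀ − (θℓ(R_K(1)δ₀)/E′(1))·e^{t}·R_K(1)f‖ ≤ M‖δ₀‖e^{−β′t}` — the growing direction is the eigenvector of record `R_K(1)f` and the coefficient is the
left-eigenvector pairing `θℓ(R_K(1)·)/E′(1)`. Same hypotheses as `flow_sub_gaugeMode_le`. [folklore] -/
theorem flow_sub_gaugeMode_le' (hL : 0 < L) (K : Esp L hL →L[ℝ] W L) (h : GardingDataKC L hL d V K D₀ D₁ V₀ c m)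
    {σ₀ : ℂ} (hσ₀ : -m < σ₀.re) (hm : 0 < m)
    (ℓ : Wcodd L →L[ℂ] ℂ) (f : Wcodd L) (θ : ℂ) (S SF : C0Semigroup ℂ (Wcodd L))
    (hS : S.generator = generatorOdd hL K h σ₀ hσ₀) (hSM : ∀ τ : ℝ≥0, ‖S.app τ‖ ≤ Real.exp (-m * τ))
    (hlap : ∀ σ : ℂ, -m < σ.re → ∀ G : Wcodd L, S.laplaceResolventFun σ G = resolventOdd hL K h σ G)
    (hdomF : (SF.generator.domain : Set (Wcodd L)) = (generatorOdd hL K h σ₀ hσ₀).domain)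
    (hgenF : ∀ (u : Wcodd L) (hu : u ∈ (generatorOdd hL K h σ₀ hσ₀).domain), ∃ hu' : u ∈ SF.generator.domain,
      SF.generator ⟨u, hu'⟩ = generatorOdd hL K h σ₀ hσ₀ ⟨u, hu⟩ + (θ * ℓ u) • f)
    (hf : f ∈ (generatorOdd hL K h σ₀ hσ₀).domain)
    {β₀ β' : ℝ} (hβ₀ : 0 < β₀) (hβ₀m : β₀ ≤ m) (hβ' : 0 < β') (hβ'β₀ : β' < β₀)
    (hzero : ∀ σ : ℂ, -β₀ < σ.re → σ ≠ 1 → evansOdd hL K h ℓ f θ σ ≠ 0)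
    (hE1 : evansOdd hL K h ℓ f θ 1 = 0) (hE'1 : deriv (evansOdd hL K h ℓ f θ) 1 ≠ 0) :
    ∃ M : ℝ, ∀ (δ₀ : Wcodd L) (t : ℝ), 0 ≤ t →
      ‖SF.app t.toNNReal δ₀ -
        ((deriv (evansOdd hL K h ℓ f θ) 1)⁻¹ * (θ * ℓ (resolventOdd hL K h 1 δ₀)) * cexp t) • resolventOdd hL K h 1 f‖ ≤
        M * ‖δ₀‖ * Real.exp (-β' * t) := by
  obtain ⟨M, hM⟩ := flow_sub_gaugeMode_le hL K h hσ₀ hm ℓ f θ S SF hS hSM hlap hdomF hgenF hf hβ₀ hβ₀m hβ' hβ'β₀ hzero hE1 hE'1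
  refine ⟨M, fun δ₀ t ht => ?_⟩
  have h1 := hM δ₀ t ht
  rwa [integral_exp_neg_mul_apply_eq hL K h hm ℓ θ S hSM hlap δ₀, hlap 1 (by simp; linarith) f] at h1

/-- **Decay on the adjoint-orthogonal hyperplane**: if `θℓ(R_K(1)δ₀) = 0` (the datum has no component along the left gauge eigenvector) then
`‖S_F(t)δ₀‖ ≤ M‖δ₀‖e^{−β′t}`. [folklore] -/
theorem flow_decay_of_orthogonal (hL : 0 < L) (K : Esp L hL →L[ℝ] W L) (h : GardingDataKC L hL d V K D₀ D₁ V₀ c m)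
    {σ₀ : ℂ} (hσ₀ : -m < σ₀.re) (hm : 0 < m)
    (ℓ : Wcodd L →L[ℂ] ℂ) (f : Wcodd L) (θ : ℂ) (S SF : C0Semigroup ℂ (Wcodd L))
    (hS : S.generator = generatorOdd hL K h σ₀ hσ₀) (hSM : ∀ τ : ℝ≥0, ‖S.app τ‖ ≤ Real.exp (-m * τ))
    (hlap : ∀ σ : ℂ, -m < σ.re → ∀ G : Wcodd L, S.laplaceResolventFun σ G = resolventOdd hL K h σ G)
    (hdomF : (SF.generator.domain : Set (Wcodd L)) = (generatorOdd hL K h σ₀ hσ₀).domain)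
    (hgenF : ∀ (u : Wcodd L) (hu : u ∈ (generatorOdd hL K h σ₀ hσ₀).domain), ∃ hu' : u ∈ SF.generator.domain,
      SF.generator ⟨u, hu'⟩ = generatorOdd hL K h σ₀ hσ₀ ⟨u, hu⟩ + (θ * ℓ u) • f)
    (hf : f ∈ (generatorOdd hL K h σ₀ hσ₀).domain)
    {β₀ β' : ℝ} (hβ₀ : 0 < β₀) (hβ₀m : β₀ ≤ m) (hβ' : 0 < β') (hβ'β₀ : β' < β₀)
    (hzero : ∀ σ : ℂ, -β₀ < σ.re → σ ≠ 1 → evansOdd hL K h ℓ f θ σ ≠ 0)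
    (hE1 : evansOdd hL K h ℓ f θ 1 = 0) (hE'1 : deriv (evansOdd hL K h ℓ f θ) 1 ≠ 0) :
    ∃ M : ℝ, ∀ (δ₀ : Wcodd L), θ * ℓ (resolventOdd hL K h 1 δ₀) = 0 → ∀ t : ℝ, 0 ≤ t →
      ‖SF.app t.toNNReal δ₀‖ ≤ M * ‖δ₀‖ * Real.exp (-β' * t) := by
  obtain ⟨M, hM⟩ := flow_sub_gaugeMode_le' hL K h hσ₀ hm ℓ f θ S SF hS hSM hlap hdomF hgenF hf hβ₀ hβ₀m hβ' hβ'β₀ hzero hE1 hE'1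
  refine ⟨M, fun δ₀ horth t ht => ?_⟩
  have h1 := hM δ₀ t ht
  rwa [horth, mul_zero, zero_mul, zero_smul, sub_zero] at h1

/-! ### §2 (APPEND) The regularity hypothesis `f ∈ D(T)` is INSIDE the S2 far-field chain of record -/

/-- **`f ∈ D(T)` from the far-field chain.** The S2 far-field hypothesis of record (`SheetREvansFarField.evansOdd_ne_zero_of_farField`,
`SheetRSpectrumEndToEnd.weakEigen_set_eq_singleton_of_record`: `a 0 = f`, `a j = R_K(z)(a (j+1) + z·a j)` for `j < 3` — «`f ∈ D(A³)`» in
resolvent-only form) already contains `f ∈ D(generatorOdd)`: `a 1 ∈ Ran R_K(z) ⊆ Wcodd`, so `f = R_K(z)(a 1 + z f)` is a resolvent value of an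
odd vector. Hence the word `flow_sub_gaugeMode_le'` asks NOTHING beyond the record's hypotheses. [folklore] -/
theorem mem_domain_generatorOdd_of_chain (hL : 0 < L) (K : Esp L hL →L[ℝ] W L) (h : GardingDataKC L hL d V K D₀ D₁ V₀ c m)
    {σ₀ : ℂ} (hσ₀ : -m < σ₀.re) {z : ℂ} (hz : -m < z.re) (f : Wcodd L) {a : ℕ → Wc L} (ha0 : a 0 = (f : Wc L))
    (hchain : ∀ j < 3, a j = resolventKC hL K h z (a (j + 1) + z • a j)) :
    f ∈ (generatorOdd hL K h σ₀ hσ₀).domain := by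
  have h1 : a 1 ∈ Wcodd L := by
    rw [hchain 1 (by norm_num)]
    exact resolventKC_mem_Wcodd hL K h z _
  have h0 : (f : Wc L) = resolventKC hL K h z (a 1 + z • (f : Wc L)) := by
    rw [← ha0]; exact hchain 0 (by norm_num)
  set g : Wcodd L := ⟨a 1 + z • (f : Wc L), (Wcodd L).add_mem h1 ((Wcodd L).smul_mem z f.2)⟩ with hg
  have hfg : f = resolventOdd hL K h z g := by
    apply Subtype.ext
    rw [coe_resolventOdd]
    exact h0
  rw [hfg]
  exact resolventOdd_mem_domain hL K h hσ₀ hz g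

/-- **«LINEARLY STABLE MODULO GAUGE» (MODEL) with the record's far-field chain in place of `f ∈ D(T)`.** Same conclusion as
`flow_sub_gaugeMode_le'`; hypotheses = (S1) datum + (P9) generator data + S2 sentences (zero set on `{Re > −β₀}`, simple zero at `1`, far-field
chain `a`). 1-D MODEL; NOT NS. [folklore] -/
theorem flow_sub_gaugeMode_le_of_chain (hL : 0 < L) (K : Esp L hL →L[ℝ] W L) (h : GardingDataKC L hL d V K D₀ D₁ V₀ c m)
    {σ₀ : ℂ} (hσ₀ : -m < σ₀.re) (hm : 0 < m)
    (ℓ : Wcodd L →L[ℂ] ℂ) (f : Wcodd L) (θ : ℂ) (S SF : C0Semigroup ℂ (Wcodd L))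
    (hS : S.generator = generatorOdd hL K h σ₀ hσ₀) (hSM : ∀ τ : ℝ≥0, ‖S.app τ‖ ≤ Real.exp (-m * τ))
    (hlap : ∀ σ : ℂ, -m < σ.re → ∀ G : Wcodd L, S.laplaceResolventFun σ G = resolventOdd hL K h σ G)
    (hdomF : (SF.generator.domain : Set (Wcodd L)) = (generatorOdd hL K h σ₀ hσ₀).domain)
    (hgenF : ∀ (u : Wcodd L) (hu : u ∈ (generatorOdd hL K h σ₀ hσ₀).domain), ∃ hu' : u ∈ SF.generator.domain,
      SF.generator ⟨u, hu'⟩ = generatorOdd hL K h σ₀ hσ₀ ⟨u, hu⟩ + (θ * ℓ u) • f)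
    {z : ℂ} (hz : -m < z.re) {a : ℕ → Wc L} (ha0 : a 0 = (f : Wc L))
    (hchain : ∀ j < 3, a j = resolventKC hL K h z (a (j + 1) + z • a j))
    {β₀ β' : ℝ} (hβ₀ : 0 < β₀) (hβ₀m : β₀ ≤ m) (hβ' : 0 < β') (hβ'β₀ : β' < β₀)
    (hzero : ∀ σ : ℂ, -β₀ < σ.re → σ ≠ 1 → evansOdd hL K h ℓ f θ σ ≠ 0)
    (hE1 : evansOdd hL K h ℓ f θ 1 = 0) (hE'1 : deriv (evansOdd hL K h ℓ f θ) 1 ≠ 0) :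
    ∃ M : ℝ, ∀ (δ₀ : Wcodd L) (t : ℝ), 0 ≤ t →
      ‖SF.app t.toNNReal δ₀ -
        ((deriv (evansOdd hL K h ℓ f θ) 1)⁻¹ * (θ * ℓ (resolventOdd hL K h 1 δ₀)) * cexp t) • resolventOdd hL K h 1 f‖ ≤
        M * ‖δ₀‖ * Real.exp (-β' * t) :=
  flow_sub_gaugeMode_le' hL K h hσ₀ hm ℓ f θ S SF hS hSM hlap hdomF hgenF
    (mem_domain_generatorOdd_of_chain hL K h hσ₀ hz f ha0 hchain) hβ₀ hβ₀m hβ' hβ'β₀ hzero hE1 hE'1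

end SheetRLinearisedStability
end Summit.NavierStokesRegularity.OSWSelfSimilar
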